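import Summits.QuantumFields.YangMills.Theorems.BalabanUVNodesN12AtTheta13OfThm1CCMPinned
import Literature.MathematicalPhysics.QuantumFieldTheory.Balaban1983to89.Node00.Record13SepCoPInhabitedOfThm1CCMGaugeR

/-!
# BalabanUVNodes ∕ N12 — THE K0⁷ → K1⁷ JUNCTION BY NAME AT THE COLLARED WITNESS `θ₁₅ᶜᶜᴹ(jM)`: the K1⁷ v5 rung body (N12 and N13 resolved) and its N12 restriction at the door-cured
# pin of dag-n21-c's re-pinned K0⁷ witness, with the K1-side input `Provisos₁₃SepCoP θ₁₅ᶜᶜᴹ(jM)` DISCHARGED from the K0⁷ R-road's own letters — (8) `VariationalThm1RegSepCoP7M`,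
# dag-n07-e's floor-carrying (9)-step `Gauge9RegSepTopStepR … (L^{jM}) c …`, `jM + 1 ≤ F.m` — and the β-box leaf at the witness (Track A, DAG node N12 = [B15, Balaban1989LargeFieldI]
# CMP **122** (1989) 175–202; cluster K1 — K1⁷ `StabilityBAtRecordR13SepCoPH` = stmt-QuantumFields-20542, helper; seat `pub-ymgap-dag-n12-d` g13 (R134 s2 «knit at the record»), 2026-08-27;
# count-neutral, CONDITIONAL, NOT a discharge)

HONEST FRAMING.  Count-neutral kernel COMPOSITION BY NAME: 12Y `…N12AtTheta13OfThm1CCM` §4 ∕ §5 and 12W-CCM `…N12AtTheta13OfThm1CCMPinned` (this seat) ∘ dag-n21-c FILE B `Node00/Record13SepCoPInhabitedOfThm1CCMGaugeR`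
(`provisos₁₃SepCoP_theta13OfThm1CCM_of_thm1GaugeR`) ∘ B′ `Record12BgRowCoClassGaugeR` (`variationalThm1GaugeRegSepCoP7MR_of_gauge9TopStepR`) ∘ A2 `Record13LettersOfThm1CCM` §5
(`hmono_theta13OfThm1CCM_of_betaLowerH`, `hcompRev_theta13OfThm1CCM_of_betaBox`).  WHAT IT SHOWS: on the K0⁷ → K1⁷ road of record (plan g75 V14: `stub_k0ROfStepTokensR13`'s letters; plan g73
K1⁷ v5: `stub_nodes13PWS`), the K1⁷ rung body at the K0⁷ witness needs from the K0 side NOTHING beyond K0⁷'s own stub-3 hypotheses and rung 2's β-box — the two cruxes JOIN BY NAME at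
`θ₁₅ᶜᶜᴹ(jM)`.  WHICH CHILD BLOCKS (the hypothesis list, nothing hidden): (8) `h15` ([15] Thm 1 — NODE 00), the (9)-step fact `h9` ([15] Sect. F (152) ∕ [6] Prop. 6 at NODE 00's member —
dag-n07-e ∕ K0⁷ stubs 1–2), `hjm`, the floor `hc`, the β-box `hβlo ∕ hβhi ∕ hβ'` ([I] (1.22) p.264; lower half UNPRINTED — node O), the six witness signs; the S-bound world binding `hC hγ hL hup`;
N05 `h05S`, N06 `h06`, N07 `h07`, N08 `h08`, N09 `h09` + `h09T`, N10 `h10`, N11 `h11` (S1ᵀ), (UV₁₃) `hUV`; N12's layer `lamW` with `hsel`, the mixed pin `hW ∕ hWdeg`, and N12's per-run displays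
BELOW THE TORUS ((1.100) pin, live-mass — NODE 00 —, Prop. 1 — dag-n12-c via 12Q⁗ —, (1.80), (1.89) — dag-n12-e's pins).  Nothing of Bałaban's is asserted; every printed fact is a hypothesis;
N12 is NOT discharged; no node is discharged; K0⁷ ∕ K1⁷ NOT closed; counts unmoved (discharged 5∕27 · Track A 5∕28).  ONE finite four-torus programme at fixed `ε = L^{-K}` — nothing continuum ∕ ℝ⁴ ∕ OS ∕
mass gap ∕ Clay.

Sources: [Balaban1989LargeFieldI] (0.2)–(0.6) p.176, Prop. 1 (1.78) p.194, (1.80) p.195, (1.89) p.198, (1.99)–(1.102) pp.200–201; [Balaban1989LargeFieldII] Thm 1 + (0.1) pp.355–356;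
[Balaban1988Convergent] Thm 1 p.262, (2.4)–(2.13) pp.255–256, (3.16)–(3.25) pp.268–270; [Balaban1985Variational] Thm 1 (8)–(9) p.279, (144)–(152) pp.300–301, Prop. 8 p.304;
[Balaban1985RegularSpaces] (1.3)–(1.9) p.77, Prop. 6 p.99; [Balaban1987RG1] (0.20) p.256, (1.22) p.264.
-/

noncomputable section

open MeasureTheory
open scoped Matrix.Norms.L2Operator

namespace Summit.QuantumFields.YangMills.BalabanUVNodes.N12AtTheta13OfThm1CCMOfStepR

open Literature.MathematicalPhysics.QuantumFieldTheory.Balaban1983to89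
open Literature.MathematicalPhysics.QuantumFieldTheory.Balaban1983to89.T4Continuum (T4Family)
open Literature.MathematicalPhysics.QuantumFieldTheory.Balaban1983to89.DagBinding
open Literature.MathematicalPhysics.QuantumFieldTheory.Balaban1983to89.Node00
open FlowStep (BetaLowerH BetaUpperH)
open FlowStepRuns (genFlow)
open B15Claim189Assembly (new189 chiPP dom)
open B15 (Prop1Printed Ineq180)
open B15.BasicStep (Claim189)
open B8Eq17ClassAkV1 (plaqsOf)
open B15RPrime1100OfRep (rPrimeDataOfSel)
open Summit.QuantumFields.YangMills.BalabanUVNodes.N12AtTheta13OfThm1CCM (kappa_nonneg_theta13OfThm1CCM E0_nonneg_theta13OfThm1CCM B0_nonneg_theta13OfThm1CCM)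
open Summit.QuantumFields.YangMills.BalabanUVNodes.N12AtRecord13SepCoPHSockets (nodesAtSomeRecordS₁₃SepCoPH_of_upS_fourPinW₀_ofHistoryBlind_ofCured_liveRepin₁₃_of_massLive_of_hasResiduals)
open Summit.QuantumFields.YangMills.BalabanUVNodes.N12AtRecord13SepCoPHS (exists_guarded_recordS₁₃SepCoPH_b15_main_pinnedN12_ofHistoryBlind_ofCured_liveRepin₁₃_of_massLive_of_hasResiduals)
open Summit.QuantumFields.YangMills.BalabanUVNodes.N12AtRecord13SepCoPHSocketsPinned (nodesAtSomeRecordS₁₃SepCoPH_of_upS_fourPinW₀_pinnedΛΩχZ_ofHistoryBlind_ofCured_liveRepin₁₃_of_massLive_of_hasResiduals)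
open B15Claim189Assembly (Setting189 half)
open B15.PrelimIntegrations (Ineq191 Ineq195)
open B15Chi124DetSets (E124)
open B15DeterminingSets (MSField)
open B14DomainGeom (Pt)
open GaugeGroup (dist1)
open GaugeField (plaqHol)
open B15Claim189PrintedConditions (omegaOfChain)
open B15Claim189PinsOfHistory (sitOfHist N0OfRecord₁₃ D189OfHist)
open B15Claim189LambdaPin (enlD)

variable {N : ℕ} [NeZero N] {F : T4Family}

/-! ## §0 The v1.5 provisos of record at `θ₁₅ᶜᶜᴹ(jM)` from K0⁷'s R-road letters + the β-box (dag-n21-c FILE B ∘ B′ ∘ A2, composed) -/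

section Provisos
variable {jM c : ℕ} {ε₀ ε₂₉ B₃ B₃' a₀ a₁ b β' : ℝ}

/-- **THE v1.5 PROVISOS `Provisos₁₃SepCoP θ₁₅ᶜᶜᴹ(jM)` FROM (8), THE FLOOR-CARRYING (9)-STEP FACT AND THE β-BOX LEAF** — dag-n21-c FILE B `provisos₁₃SepCoP_theta13OfThm1CCM_of_thm1GaugeR` with its R gauge sentence
fed by B′ `variationalThm1GaugeRegSepCoP7MR_of_gauge9TopStepR` and its two history clauses by A2 §5 `hmono_theta13OfThm1CCM_of_betaLowerH` ∕ `hcompRev_theta13OfThm1CCM_of_betaBox` (one application each; the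
composition dag-n21-c's ∃-closers `exists_k0SepCoP…_of_gauge9TopStepR_of_betaBox` perform INSIDE the `∃`, exposed here AT the witness so that K1-side sockets can read it).  CONDITIONAL. [cite: Balaban1985Variational, (6)–(7) p.278, Thm 1 (8)–(9) p.279, (144)–(152) pp.300–301, Prop. 8 p.304; Balaban1985RegularSpaces, (1.3)–(1.9) p.77, Prop. 6 p.99; Balaban1988Convergent, Thm 1 p.262, (2.4)–(2.8) pp.255–256, (2.12)–(2.13) p.256, (3.16)–(3.22) pp.268–269; Balaban1987RG1, (0.20) p.256, (1.11)–(1.12) p.262, (1.22) p.264; Balaban1989LargeFieldI, (0.3)–(0.4) p.176 (bookkeeping)] -/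
theorem provisos₁₃SepCoP_theta13OfThm1CCM_of_gauge9TopStepR_of_betaBox (hjm : jM + 1 ≤ F.m) (hε : 0 < ε₀) (hε' : 0 < ε₂₉) (hB : 0 ≤ B₃) (hB' : 0 ≤ B₃') (ha₀ : 0 < a₀) (ha₁ : 0 < a₁)
    (h15 : VariationalThm1RegSepCoP7M F N B₃ a₀ a₁) (hc : c ≤ F.L ^ jM) (h9 : Gauge9RegSepTopStepR F N (fun ν K Ω => suppDomOfRecord F ν K Ω) (F.L ^ jM) c B₃ B₃' a₀ a₁)
    (hb : 0 ≤ b) (hβlo : BetaLowerH b (1 / 2) (betaOfRecord₁₃ F N (theta13OfThm1CCM F N jM ε₀ ε₂₉ B₃ B₃' a₀ a₁))) (hβhi : BetaUpperH β' (1 / 2) (betaOfRecord₁₃ F N (theta13OfThm1CCM F N jM ε₀ ε₂₉ B₃ B₃' a₀ a₁))) (hβ' : β' ≤ 3) :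
    (theta13OfThm1CCM F N jM ε₀ ε₂₉ B₃ B₃' a₀ a₁).Provisos₁₃SepCoP F N :=
  provisos₁₃SepCoP_theta13OfThm1CCM_of_thm1GaugeR hjm hε hε' hB hB' ha₀ ha₁ h15 hc (variationalThm1GaugeRegSepCoP7MR_of_gauge9TopStepR h9)
    (hmono_theta13OfThm1CCM_of_betaLowerH hb hβlo) (hcompRev_theta13OfThm1CCM_of_betaBox hB hB' ha₀.le ha₁.le hb hβlo hβhi hβ')

end Provisos

/-! ## §1 ★★★★ THE K1⁷ v5 RUNG BODY AT THE DOOR-CURED COLLARED WITNESS FROM K0⁷'s R-ROAD LETTERS (12Y §4 ∘ §0) -/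

section RungOfStepR
variable (jM : ℕ) (ε₀ ε₂₉ B₃ B₃' a₀ a₁ : ℝ) (lamW : ResidW F N)
  (Mstar : ℕ) (ops : OpsY N (theta13OfThm1CCM F N jM ε₀ ε₂₉ B₃ B₃' a₀ a₁).toStage3Params Mstar) (ζ : ResidZ F N) (W₀ : B12.RunParams → PrintedCarriers15) (w : WorldP)

/-- **★★★★ THE K0⁷ → K1⁷ JUNCTION BY NAME: THE v5 RUNG BODY AT THE DOOR-CURED COLLARED WITNESS `θ₁₅ᶜᶜᴹ(jM)` WITH ITS K1-SIDE INPUT `Provisos₁₃SepCoP θ₁₅ᶜᶜᴹ(jM)` DISCHARGED FROM K0⁷'s OWN R-ROAD LETTERS** —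
12Y §4 with `hP := provisos₁₃SepCoP_theta13OfThm1CCM_of_gauge9TopStepR_of_betaBox …` (§0): what the K1⁷ closer of `stub_nodes13PWS` receives from the K0 side is no longer an opaque proviso package but
EXACTLY plan g75's V14 stub 3 `K0ROfStepTokensRAt F` letters at `M := F.L ^ jM`, floor `c ≤ F.L ^ jM` — (8) `VariationalThm1RegSepCoP7M F N B₃ a₀ a₁` ([15] Thm 1, NODE 00), dag-n07-e's floor-carrying (9)-step
`Gauge9RegSepTopStepR F N suppDom (F.L ^ jM) c B₃ B₃' a₀ a₁` ([15] Sect. F ∕ [6] Prop. 6), the non-wrapping binder `jM + 1 ≤ F.m` — plus the β-box leaf at the witness ([I] (1.22); rung 2's own letters `hlo ∕ hhi`)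
and the six witness signs.  N12 (mixed W-pin, 12E) and N13 (dag-n11-e) resolved as in 12Y §4; the world binding, rows h05S–h11 ∕ hUV, the layer `lamW` with `hsel` and N12's per-run displays below the torus
DISPLAYED.  At `N := 2` the conclusion IS the body of the registered `NodesAtSomeRecord13PWS F` (certificate of 12T-H).  COMPOSITE and CONDITIONAL: nothing of Bałaban asserted, no node discharged, K0⁷ ∕ K1⁷ NOT closed.
[cite: Balaban1989LargeFieldII, Thm 1 p.355, (0.1) pp.355–356; Balaban1989LargeFieldI, (0.2)–(0.6) p.176, Prop. 1 (1.78) p.194, (1.80) p.195, (1.89) p.198, (1.99)–(1.102) pp.200–201; Balaban1988Convergent, Thm 1 p.262, (2.4)–(2.13) pp.255–256, (2.18) p.257, (3.16)–(3.25) pp.268–270; Balaban1985Variational, Thm 1 (8)–(9) p.279, (144)–(152) pp.300–301, Prop. 8 p.304; Balaban1985RegularSpaces, (1.3)–(1.9) p.77, Prop. 6 p.99, Thm 8 (1.146) p.101; Balaban1985UV3, Thm 1 p.257, Thm 2 p.272; Balaban1985BackgroundPropagators, Thm 3.1 p.397; Balaban1987RG1, Thm 1 p.259, (0.20) p.256,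 (1.22) p.264, Lemma 4 p.280; Balaban1988RG2Cluster, Lemmas 1–3 pp.9–20 (bookkeeping)] -/
theorem nodesAtSomeRecordS₁₃SepCoPH_of_upS_fourPinW₀_ofHistoryBlind_ofCured_theta13OfThm1CCM_of_massLive_of_gauge9TopStepR_of_betaBox
    (hε : 0 < ε₀) (hε' : 0 < ε₂₉) (hB : 0 ≤ B₃) (hB' : 0 ≤ B₃') (ha₀ : 0 < a₀) (ha₁ : 0 < a₁)
    -- K0⁷'s R-ROAD LETTERS AT THE COLLARED WITNESS = plan g75 V14 stub 3 `K0ROfStepTokensRAt F`'s own hypotheses read at `M := F.L ^ jM` with a floor `c ≤ F.L ^ jM` (dag-n21-c FILE B ∕ dag-n07-e FILE 29)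
    (hjm : jM + 1 ≤ F.m) (h15 : VariationalThm1RegSepCoP7M F N B₃ a₀ a₁) {c : ℕ} (hc : c ≤ F.L ^ jM)
    (h9 : Gauge9RegSepTopStepR F N (fun ν K Ω => suppDomOfRecord F ν K Ω) (F.L ^ jM) c B₃ B₃' a₀ a₁)
    -- the β-box leaf at the witness ([I] (1.22) p.264 — rung 2's own letters; the two history clauses from it by dag-n21-c A2 §5)
    {b β' : ℝ} (hb : 0 ≤ b) (hβlo : BetaLowerH b (1 / 2) (betaOfRecord₁₃ F N (theta13OfThm1CCM F N jM ε₀ ε₂₉ B₃ B₃' a₀ a₁))) (hβhi : BetaUpperH β' (1 / 2) (betaOfRecord₁₃ F N (theta13OfThm1CCM F N jM ε₀ ε₂₉ B₃ B₃' a₀ a₁))) (hβ' : β' ≤ 3)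
    (hW : ∀ P : B12.RunParams, lamW.kSel P < P.K → W₀ P = WOfRecord₁₃ F N (theta13OfThm1CCM F N jM ε₀ ε₂₉ B₃ B₃' a₀ a₁) lamW P) (hWdeg : ∀ P : B12.RunParams, P.K ≤ lamW.kSel P → B15Leaf (W₀ P))
    (hC : w.C = (datumOfRecord₁₃SepCoPH F N (Stage13HParams.ofHistoryBlind F N (Stage13RParams.ofCured F N (theta13OfThm1CCM F N jM ε₀ ε₂₉ B₃ B₃' a₀ a₁))) (provisos₁₃SepCoP_theta13OfThm1CCM_of_gauge9TopStepR_of_betaBox hjm hε hε' hB hB' ha₀ ha₁ h15 hc h9 hb hβlo hβhi hβ').ofCured.ofHistoryBlind).C) (hγ : 0 < w.γ ∧ w.γ ≤ (theta13OfThm1CCM F N jM ε₀ ε₂₉ B₃ B₃' a₀ a₁).γ) (hL : w.L = ((theta13OfThm1CCM F N jM ε₀ ε₂₉ B₃ B₃' a₀ a₁).L : ℝ))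
    (hup : ∀ P, w.up P = upOfRecord₅CS F N ((((((Stage13HParams.ofHistoryBlind F N (Stage13RParams.ofCured F N (theta13OfThm1CCM F N jM ε₀ ε₂₉ B₃ B₃' a₀ a₁))).toStage5₁₃CoPH F N).pinB10 F N).pinY F N (Y9OfRecord N (theta13OfThm1CCM F N jM ε₀ ε₂₉ B₃ B₃' a₀ a₁).toStage3Params Mstar ops)).pinZ F N (Z11OfRecord F N ζ)).pinW F N W₀) P)
    (h05S : ∀ P : B12.RunParams, (upOfRecord₅CS F N ((((((Stage13HParams.ofHistoryBlind F N (Stage13RParams.ofCured F N (theta13OfThm1CCM F N jM ε₀ ε₂₉ B₃ B₃' a₀ a₁))).toStage5₁₃CoPH F N).pinB10 F N).pinY F N (Y9OfRecord N (theta13OfThm1CCM F N jM ε₀ ε₂₉ B₃ B₃' a₀ a₁).toStage3Params Mstar ops)).pinZ F N (Z11OfRecord F N ζ)).pinW F N W₀) P).b8)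
    (h06 : B9LeafX (Y9OfRecord N (theta13OfThm1CCM F N jM ε₀ ε₂₉ B₃ B₃' a₀ a₁).toStage3Params Mstar ops))
    (h07 : B11Leaf (Z11OfRecord F N ζ))
    (h08 : PrintedUV3V N (theta13OfThm1CCM F N jM ε₀ ε₂₉ B₃ B₃' a₀ a₁).L)
    (h09 : ∀ P : B12.RunParams, B12Sec2to5.Lemma4Printed ((theta13OfThm1CCM F N jM ε₀ ε₂₉ B₃ B₃' a₀ a₁).res.X P).F12 ((theta13OfThm1CCM F N jM ε₀ ε₂₉ B₃ B₃' a₀ a₁).res.X P).c12)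
    (h09T : ∀ P : B12.RunParams, (leavesP w P).smallCouplings → (leavesP w P).smallFieldInductive)
    (h10 : ∀ P : B12.RunParams, B9LeafX (Y9OfRecord N (theta13OfThm1CCM F N jM ε₀ ε₂₉ B₃ B₃' a₀ a₁).toStage3Params Mstar ops) →
      (B10.Thm1PrintedCompact (((((((Stage13HParams.ofHistoryBlind F N (Stage13RParams.ofCured F N (theta13OfThm1CCM F N jM ε₀ ε₂₉ B₃ B₃' a₀ a₁))).toStage5₁₃CoPH F N).pinB10 F N).pinY F N (Y9OfRecord N (theta13OfThm1CCM F N jM ε₀ ε₂₉ B₃ B₃' a₀ a₁).toStage3Params Mstar ops)).pinZ F N (Z11OfRecord F N ζ)).pinW F N W₀).res.X P).runs10 ∧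
          B10.Thm2Printed (((((((Stage13HParams.ofHistoryBlind F N (Stage13RParams.ofCured F N (theta13OfThm1CCM F N jM ε₀ ε₂₉ B₃ B₃' a₀ a₁))).toStage5₁₃CoPH F N).pinB10 F N).pinY F N (Y9OfRecord N (theta13OfThm1CCM F N jM ε₀ ε₂₉ B₃ B₃' a₀ a₁).toStage3Params Mstar ops)).pinZ F N (Z11OfRecord F N ζ)).pinW F N W₀).res.X P).runs10) →
        B11Leaf (Z11OfRecord F N ζ) → B12Sec2to5.Lemma4Printed ((theta13OfThm1CCM F N jM ε₀ ε₂₉ B₃ B₃' a₀ a₁).res.X P).F12 ((theta13OfThm1CCM F N jM ε₀ ε₂₉ B₃ B₃' a₀ a₁).res.X P).c12 →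
          B13.Lemma1Printed ((theta13OfThm1CCM F N jM ε₀ ε₂₉ B₃ B₃' a₀ a₁).res.X P).S13 ((theta13OfThm1CCM F N jM ε₀ ε₂₉ B₃ B₃' a₀ a₁).res.X P).c13 ∧ B13.Lemma2Printed ((theta13OfThm1CCM F N jM ε₀ ε₂₉ B₃ B₃' a₀ a₁).res.X P).S13 ((theta13OfThm1CCM F N jM ε₀ ε₂₉ B₃ B₃' a₀ a₁).res.X P).c13 ∧
            B13.Lemma3Printed ((theta13OfThm1CCM F N jM ε₀ ε₂₉ B₃ B₃' a₀ a₁).res.X P).S13 ((theta13OfThm1CCM F N jM ε₀ ε₂₉ B₃ B₃' a₀ a₁).res.X P).c13)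
    (h11 : ∀ P : B12.RunParams, (leavesP w P).b7 → (leavesP w P).b8 → (leavesP w P).b9 → (leavesP w P).b10 → (leavesP w P).b11 →
      (leavesP w P).smallCouplings → (leavesP w P).smallFieldInductive → (leavesP w P).flowControl →
        ∀ k, k < P.K → SLaw₁₃CoPH F N (Stage13HParams.ofHistoryBlind F N (Stage13RParams.ofCured F N (theta13OfThm1CCM F N jM ε₀ ε₂₉ B₃ B₃' a₀ a₁))) P k → TLaw₁₃CoPH F N (Stage13HParams.ofHistoryBlind F N (Stage13RParams.ofCured F N (theta13OfThm1CCM F N jM ε₀ ε₂₉ B₃ B₃' a₀ a₁))) P k)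
    (hUV : ∀ P : B12.RunParams, (genFlow (betaOfRecord₁₃ F N (theta13OfThm1CCM F N jM ε₀ ε₂₉ B₃ B₃' a₀ a₁)) P.g0).InInterval w.γ P.K → ∀ k, k ≤ P.K → SLaw₁₃CoPH F N (Stage13HParams.ofHistoryBlind F N (Stage13RParams.ofCured F N (theta13OfThm1CCM F N jM ε₀ ε₂₉ B₃ B₃' a₀ a₁))) P k →
      ∀ U : GaugeField (F.P P.K) k (SU N),
        chiβOfRecord₁₃ F N (theta13OfThm1CCM F N jM ε₀ ε₂₉ B₃ B₃' a₀ a₁) P.K (gOfRecord₁₃ F N (theta13OfThm1CCM F N jM ε₀ ε₂₉ B₃ B₃' a₀ a₁) P) k U *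
              Real.exp (-(1 / (gOfRecord₁₃ F N (theta13OfThm1CCM F N jM ε₀ ε₂₉ B₃ B₃' a₀ a₁) P k) ^ 2 * wilsonBGOfRecord F N (theta13OfThm1CCM F N jM ε₀ ε₂₉ B₃ B₃' a₀ a₁).εbg P k U)
                - w.em (gOfRecord₁₃ F N (theta13OfThm1CCM F N jM ε₀ ε₂₉ B₃ B₃' a₀ a₁) P k) * (Fintype.card (Site (F.P P.K) k) : ℝ)) ≤ densOfRecord₁₃ F N (theta13OfThm1CCM F N jM ε₀ ε₂₉ B₃ B₃' a₀ a₁) P k U ∧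
        densOfRecord₁₃ F N (theta13OfThm1CCM F N jM ε₀ ε₂₉ B₃ B₃' a₀ a₁) P k U ≤ Real.exp (w.ep (gOfRecord₁₃ F N (theta13OfThm1CCM F N jM ε₀ ε₂₉ B₃ B₃' a₀ a₁) P k) * (Fintype.card (Site (F.P P.K) k) : ℝ)))
    (h12pin : ∀ P : B12.RunParams, lamW.kSel P < P.K → lamW.D1100 P
      = rPrimeDataOfSel (reprTOfRecord₁₃ F N (theta13OfThm1CCM F N jM ε₀ ε₂₉ B₃ B₃' a₀ a₁) P (lamW.kSel P))
          ((theta13OfThm1CCM F N jM ε₀ ε₂₉ B₃ B₃' a₀ a₁).ppSel P (gOfRecord₁₃ F N (theta13OfThm1CCM F N jM ε₀ ε₂₉ B₃ B₃' a₀ a₁) P) (lamW.kSel P + 1))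
          (fibOfSeq F (theta13OfThm1CCM F N jM ε₀ ε₂₉ B₃ B₃' a₀ a₁).ν (theta13OfThm1CCM F N jM ε₀ ε₂₉ B₃ B₃' a₀ a₁).τ9 P (gOfRecord₁₃ F N (theta13OfThm1CCM F N jM ε₀ ε₂₉ B₃ B₃' a₀ a₁) P) (lamW.kSel P + 1)))
    (h12mass : ∀ P : B12.RunParams, lamW.kSel P < P.K → ∀ s, LiveSeq F N (theta13OfThm1CCM F N jM ε₀ ε₂₉ B₃ B₃' a₀ a₁).ν (theta13OfThm1CCM F N jM ε₀ ε₂₉ B₃ B₃' a₀ a₁).τ9 P (gOfRecord₁₃ F N (theta13OfThm1CCM F N jM ε₀ ε₂₉ B₃ B₃' a₀ a₁) P) (lamW.kSel P + 1)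
        (slotsTOfRecord F N (theta13OfThm1CCM F N jM ε₀ ε₂₉ B₃ B₃' a₀ a₁).ν (theta13OfThm1CCM F N jM ε₀ ε₂₉ B₃ B₃' a₀ a₁).τ9 (EOfRecord₁₃ F N (theta13OfThm1CCM F N jM ε₀ ε₂₉ B₃ B₃' a₀ a₁)) (wOfRecord₉ F N (theta13OfThm1CCM F N jM ε₀ ε₂₉ B₃ B₃' a₀ a₁).toStage9Params)
          (theta13OfThm1CCM F N jM ε₀ ε₂₉ B₃ B₃' a₀ a₁).ppSel P (gOfRecord₁₃ F N (theta13OfThm1CCM F N jM ε₀ ε₂₉ B₃ B₃' a₀ a₁) P) (lamW.kSel P + 1)) s →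
      0 < ∫ V, rterm (reprTOfRecord₁₃ F N (theta13OfThm1CCM F N jM ε₀ ε₂₉ B₃ B₃' a₀ a₁) P (lamW.kSel P)) s V ∂(fieldMeasure (F.P P.K) (lamW.kSel P + 1) (SU N)))
    (h12P1 : ∀ P : B12.RunParams, lamW.kSel P < P.K → Prop1Printed (lamW.LF P))
    (h12i180 : ∀ P : B12.RunParams, lamW.kSel P < P.K → ∀ U, new189 (lamW.D189 P) U → ∀ i, (lamW.D189 P).h ≤ i → i ≤ (lamW.D189 P).k →
      ∀ q ∈ plaqsOf (dom (lamW.D189 P) i),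
        Ineq180 ((lamW.D189 P).dev0 U q) ((lamW.D189 P).ε (lamW.D189 P).k) (lamW.D189 P).η (lamW.D189 P).B₃ (lamW.D189 P).B₅ (lamW.D189 P).M (lamW.D189 P).δ
          ((lamW.D189 P).dist q) (lamW.D189 P).O1)
    (h12c189 : ∀ P : B12.RunParams, lamW.kSel P < P.K → Claim189 (new189 (lamW.D189 P)) (chiPP (lamW.D189 P)))
    (hsel : ∀ P : B12.RunParams, 1 ≤ P.K → lamW.kSel P < P.K) :
    ∃ (θ' : Stage13HParams F N) (h' : θ'.Provisos₁₃SepCoPH F N) (w : WorldP), (θ'.ZhUnity F N ∧ θ'.SlotsNondegenerate₁₃ F N) ∧ θ'.Admissible F N ∧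
      (∃ (θ'' : Stage13HParams F N) (h'' : θ''.Provisos₁₃SepCoPH F N), θ''.Admissible F N ∧
        datumOfRecord₁₃SepCoPH F N θ' h' = datumOfRecord₁₃SepCoPH F N θ'' h'' ∧ w.C = (datumOfRecord₁₃SepCoPH F N θ' h').C ∧ (0 < w.γ ∧ w.γ ≤ θ''.γ) ∧
        w.L = (θ''.L : ℝ) ∧ ∀ P : B12.RunParams, w.up P = upOfRecord₅CS F N (θ''.toStage5₁₃CoPH F N) P) ∧
      (∀ P : B12.RunParams, Nodes (leavesP w P)) ∧ PrintedUV3V N θ'.L ∧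
      ∃ lam : ResidW F N, (∀ P : B12.RunParams, 1 ≤ P.K → lam.kSel P < P.K) ∧
        ∀ P : B12.RunParams, lam.kSel P < P.K → ((leavesP w P).rBasicStep ↔ B15Leaf (WOfRecord₁₃ F N θ'.toStage13Params lam P)) :=
  nodesAtSomeRecordS₁₃SepCoPH_of_upS_fourPinW₀_ofHistoryBlind_ofCured_liveRepin₁₃_of_massLive_of_hasResiduals
    (theta13OfNumerics F N (stage12NumericsOfThm1CCM F.L jM ε₀ B₃ B₃' a₀ a₁) ε₂₉ (zeta316OfRecord F N (stage12NumericsOfThm1CCM F.L jM ε₀ B₃ B₃' a₀ a₁).ν (stage12NumericsOfThm1CCM F.L jM ε₀ B₃ B₃' a₀ a₁).τ9.M (stage12NumericsOfThm1CCM F.L jM ε₀ B₃ B₃' a₀ a₁).A₁) (RzOfRecord F N) (ZtOfRecord F N)) lamW Mstar ops ζ W₀ w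
    (hasResidualsOfRecord_theta13OfNumerics F N (stage12NumericsOfThm1CCM F.L jM ε₀ B₃ B₃' a₀ a₁) ε₂₉)
    (provisos₁₃SepCoP_theta13OfThm1CCM_of_gauge9TopStepR_of_betaBox hjm hε hε' hB hB' ha₀ ha₁ h15 hc h9 hb hβlo hβhi hβ')
    (admissible_theta13OfNumerics F N (zeta316OfRecord F N (stage12NumericsOfThm1CCM F.L jM ε₀ B₃ B₃' a₀ a₁).ν (stage12NumericsOfThm1CCM F.L jM ε₀ B₃ B₃' a₀ a₁).τ9.M (stage12NumericsOfThm1CCM F.L jM ε₀ B₃ B₃' a₀ a₁).A₁) (RzOfRecord F N) (ZtOfRecord F N) (stage12NumericsOfThm1CCM_pos F.hL.2.le hε hB hB' ha₀ ha₁) hε')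
    (kappa_nonneg_theta13OfThm1CCM F N jM ε₀ ε₂₉ B₃ B₃' a₀ a₁) (E0_nonneg_theta13OfThm1CCM F N jM ε₀ ε₂₉ B₃ B₃' a₀ a₁) (B0_nonneg_theta13OfThm1CCM F N jM ε₀ ε₂₉ B₃ B₃' a₀ a₁)
    hW hWdeg hC hγ hL hup h05S h06 h07 h08 h09 h09T h10 h11 hUV h12pin h12mass h12P1 h12i180 h12c189 hsel

end RungOfStepR

/-! ## §2 ★★★★ THE RUNG RESTRICTED TO N12, SAME INPUTS (12Y §5 ∘ §0) -/

section N12RungOfStepR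
variable (jM : ℕ) (ε₀ ε₂₉ B₃ B₃' a₀ a₁ : ℝ) (lamW : ResidW F N)

/-- **★★★★ THE RUNG RESTRICTED TO N12 AT THE DOOR-CURED COLLARED WITNESS FROM K0⁷'s R-ROAD LETTERS** (12Y §5 with `hP := §0`): K0-side = (8) + the (9)-step fact at `(L^{jM}, c)` + `jM + 1 ≤ F.m`
+ the β-box at the witness + signs; N12's layer `lamW`, `hsel` and per-run displays below the torus DISPLAYED.  The N12 line of the which-child-blocks table ON THE K0⁷ → K1⁷ ROAD OF RECORD.  NOT the stub;
CONDITIONAL; count-neutral. [cite: Balaban1989LargeFieldII, Thm 1 p.355, (0.1) pp.355–356; Balaban1989LargeFieldI, (0.2)–(0.6) p.176, Prop. 1 (1.78) p.194, (1.80) p.195, (1.89) p.198, (1.99)–(1.102) pp.200–201; Balaban1988Convergent, (2.10)–(2.13) p.256, (3.16)–(3.25) pp.268–270; Balaban1985Variational, Thm 1 (8)–(9) p.279, (152) p.301, Prop. 8 p.304; Balaban1985RegularSpaces, (1.3)–(1.9) p.77, Prop. 6 p.99; Balaban1987RG1, (0.20) p.256, (1.22) p.264 (bookkeeping)] -/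
theorem exists_guarded_recordS₁₃SepCoPH_b15_main_pinnedN12_ofHistoryBlind_ofCured_theta13OfThm1CCM_of_massLive_of_gauge9TopStepR_of_betaBox (hε : 0 < ε₀) (hε' : 0 < ε₂₉) (hB : 0 ≤ B₃) (hB' : 0 ≤ B₃') (ha₀ : 0 < a₀) (ha₁ : 0 < a₁)
    -- K0⁷'s R-ROAD LETTERS AT THE COLLARED WITNESS = plan g75 V14 stub 3 `K0ROfStepTokensRAt F`'s own hypotheses read at `M := F.L ^ jM` with a floor `c ≤ F.L ^ jM` (dag-n21-c FILE B ∕ dag-n07-e FILE 29)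
    (hjm : jM + 1 ≤ F.m) (h15 : VariationalThm1RegSepCoP7M F N B₃ a₀ a₁) {c : ℕ} (hc : c ≤ F.L ^ jM)
    (h9 : Gauge9RegSepTopStepR F N (fun ν K Ω => suppDomOfRecord F ν K Ω) (F.L ^ jM) c B₃ B₃' a₀ a₁)
    -- the β-box leaf at the witness ([I] (1.22) p.264 — rung 2's own letters; the two history clauses from it by dag-n21-c A2 §5)
    {b β' : ℝ} (hb : 0 ≤ b) (hβlo : BetaLowerH b (1 / 2) (betaOfRecord₁₃ F N (theta13OfThm1CCM F N jM ε₀ ε₂₉ B₃ B₃' a₀ a₁))) (hβhi : BetaUpperH β' (1 / 2) (betaOfRecord₁₃ F N (theta13OfThm1CCM F N jM ε₀ ε₂₉ B₃ B₃' a₀ a₁))) (hβ' : β' ≤ 3)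
    (h12pin : ∀ P : B12.RunParams, lamW.kSel P < P.K → lamW.D1100 P
      = rPrimeDataOfSel (reprTOfRecord₁₃ F N (theta13OfThm1CCM F N jM ε₀ ε₂₉ B₃ B₃' a₀ a₁) P (lamW.kSel P))
          ((theta13OfThm1CCM F N jM ε₀ ε₂₉ B₃ B₃' a₀ a₁).ppSel P (gOfRecord₁₃ F N (theta13OfThm1CCM F N jM ε₀ ε₂₉ B₃ B₃' a₀ a₁) P) (lamW.kSel P + 1))
          (fibOfSeq F (theta13OfThm1CCM F N jM ε₀ ε₂₉ B₃ B₃' a₀ a₁).ν (theta13OfThm1CCM F N jM ε₀ ε₂₉ B₃ B₃' a₀ a₁).τ9 P (gOfRecord₁₃ F N (theta13OfThm1CCM F N jM ε₀ ε₂₉ B₃ B₃' a₀ a₁) P) (lamW.kSel P + 1)))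
    (h12mass : ∀ P : B12.RunParams, lamW.kSel P < P.K → ∀ s, LiveSeq F N (theta13OfThm1CCM F N jM ε₀ ε₂₉ B₃ B₃' a₀ a₁).ν (theta13OfThm1CCM F N jM ε₀ ε₂₉ B₃ B₃' a₀ a₁).τ9 P (gOfRecord₁₃ F N (theta13OfThm1CCM F N jM ε₀ ε₂₉ B₃ B₃' a₀ a₁) P) (lamW.kSel P + 1)
        (slotsTOfRecord F N (theta13OfThm1CCM F N jM ε₀ ε₂₉ B₃ B₃' a₀ a₁).ν (theta13OfThm1CCM F N jM ε₀ ε₂₉ B₃ B₃' a₀ a₁).τ9 (EOfRecord₁₃ F N (theta13OfThm1CCM F N jM ε₀ ε₂₉ B₃ B₃' a₀ a₁)) (wOfRecord₉ F N (theta13OfThm1CCM F N jM ε₀ ε₂₉ B₃ B₃' a₀ a₁).toStage9Params)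
          (theta13OfThm1CCM F N jM ε₀ ε₂₉ B₃ B₃' a₀ a₁).ppSel P (gOfRecord₁₃ F N (theta13OfThm1CCM F N jM ε₀ ε₂₉ B₃ B₃' a₀ a₁) P) (lamW.kSel P + 1)) s →
      0 < ∫ V, rterm (reprTOfRecord₁₃ F N (theta13OfThm1CCM F N jM ε₀ ε₂₉ B₃ B₃' a₀ a₁) P (lamW.kSel P)) s V ∂(fieldMeasure (F.P P.K) (lamW.kSel P + 1) (SU N)))
    (h12P1 : ∀ P : B12.RunParams, lamW.kSel P < P.K → Prop1Printed (lamW.LF P))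
    (h12i180 : ∀ P : B12.RunParams, lamW.kSel P < P.K → ∀ U, new189 (lamW.D189 P) U → ∀ i, (lamW.D189 P).h ≤ i → i ≤ (lamW.D189 P).k →
      ∀ q ∈ plaqsOf (dom (lamW.D189 P) i),
        Ineq180 ((lamW.D189 P).dev0 U q) ((lamW.D189 P).ε (lamW.D189 P).k) (lamW.D189 P).η (lamW.D189 P).B₃ (lamW.D189 P).B₅ (lamW.D189 P).M (lamW.D189 P).δ
          ((lamW.D189 P).dist q) (lamW.D189 P).O1)
    (h12c189 : ∀ P : B12.RunParams, lamW.kSel P < P.K → Claim189 (new189 (lamW.D189 P)) (chiPP (lamW.D189 P)))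
    (hsel : ∀ P : B12.RunParams, 1 ≤ P.K → lamW.kSel P < P.K) :
    ∃ (θ' : Stage13HParams F N) (h' : θ'.Provisos₁₃SepCoPH F N) (w : WorldP), (θ'.ZhUnity F N ∧ θ'.SlotsNondegenerate₁₃ F N) ∧ θ'.Admissible F N ∧
      (∃ (θ'' : Stage13HParams F N) (h'' : θ''.Provisos₁₃SepCoPH F N), θ''.Admissible F N ∧
        datumOfRecord₁₃SepCoPH F N θ' h' = datumOfRecord₁₃SepCoPH F N θ'' h'' ∧ w.C = (datumOfRecord₁₃SepCoPH F N θ' h').C ∧ (0 < w.γ ∧ w.γ ≤ θ''.γ) ∧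
        w.L = (θ''.L : ℝ) ∧ ∀ P : B12.RunParams, w.up P = upOfRecord₅CS F N (θ''.toStage5₁₃CoPH F N) P) ∧
      (∀ P : B12.RunParams, Dag.B15_main (leavesP w P)) ∧
      ∃ lam : ResidW F N, (∀ P : B12.RunParams, 1 ≤ P.K → lam.kSel P < P.K) ∧
        ∀ P : B12.RunParams, lam.kSel P < P.K → ((leavesP w P).rBasicStep ↔ B15Leaf (WOfRecord₁₃ F N θ'.toStage13Params lam P)) :=
  exists_guarded_recordS₁₃SepCoPH_b15_main_pinnedN12_ofHistoryBlind_ofCured_liveRepin₁₃_of_massLive_of_hasResiduals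
    (theta13OfNumerics F N (stage12NumericsOfThm1CCM F.L jM ε₀ B₃ B₃' a₀ a₁) ε₂₉
      (zeta316OfRecord F N (stage12NumericsOfThm1CCM F.L jM ε₀ B₃ B₃' a₀ a₁).ν (stage12NumericsOfThm1CCM F.L jM ε₀ B₃ B₃' a₀ a₁).τ9.M (stage12NumericsOfThm1CCM F.L jM ε₀ B₃ B₃' a₀ a₁).A₁)
      (RzOfRecord F N) (ZtOfRecord F N)) lamW
    (hasResidualsOfRecord_theta13OfNumerics F N (stage12NumericsOfThm1CCM F.L jM ε₀ B₃ B₃' a₀ a₁) ε₂₉)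
    (provisos₁₃SepCoP_theta13OfThm1CCM_of_gauge9TopStepR_of_betaBox hjm hε hε' hB hB' ha₀ ha₁ h15 hc h9 hb hβlo hβhi hβ')
    (admissible_theta13OfNumerics F N (zeta316OfRecord F N (stage12NumericsOfThm1CCM F.L jM ε₀ B₃ B₃' a₀ a₁).ν (stage12NumericsOfThm1CCM F.L jM ε₀ B₃ B₃' a₀ a₁).τ9.M
      (stage12NumericsOfThm1CCM F.L jM ε₀ B₃ B₃' a₀ a₁).A₁) (RzOfRecord F N) (ZtOfRecord F N) (stage12NumericsOfThm1CCM_pos F.hL.2.le hε hB hB' ha₀ ha₁) hε')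
    h12pin h12mass h12P1 h12i180 h12c189 hsel

end N12RungOfStepR

/-! ## §3 ★★★★ THE ΛΩχZ-PINNED RUNG BODY AT THE DOOR-CURED COLLARED WITNESS, SAME K0-SIDE INPUTS (12W-CCM ∘ §0) -/

section PinnedOfStepR
variable (jM : ℕ) (ε₀ ε₂₉ B₃ B₃' a₀ a₁ : ℝ) (lam : ResidW F N) (σ : ∀ P : B12.RunParams, Sit189 F N P.K)
  (s : ∀ P : B12.RunParams, SeqOfRecord F (theta13OfThm1CCM F N jM ε₀ ε₂₉ B₃ B₃' a₀ a₁).ν (theta13OfThm1CCM F N jM ε₀ ε₂₉ B₃ B₃' a₀ a₁).τ9.M (gOfRecord₁₃ F N (theta13OfThm1CCM F N jM ε₀ ε₂₉ B₃ B₃' a₀ a₁) P) P.K (lam.kSel P + 1)) (Nm : B12.RunParams → ℕ) (p₁ : ℕ)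
  (Mstar : ℕ) (ops : OpsY N (theta13OfThm1CCM F N jM ε₀ ε₂₉ B₃ B₃' a₀ a₁).toStage3Params Mstar) (ζ : ResidZ F N) (W₀ : B12.RunParams → PrintedCarriers15) (w : WorldP)

/-- **★★★★ THE SAME WITH THE K1-SIDE INPUT DISCHARGED FROM K0⁷'s R-ROAD LETTERS** (`hP := §0`): at the door-cured collared witness, the K1⁷ v5 rung body with N12 read at its layer of record `λᴾ` and N13
resolved needs — besides the nodes' displayed rows and N12's located per-run inputs — from the K0 side EXACTLY (8) `h15`, the floor-carrying (9)-step `h9` at `(L^{jM}, c)`, `hjm`, and the β-box at the witness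
(rung 2's letters).  The most complete kernel census of this seat for the K0⁷ → K1⁷ road.  COMPOSITE and CONDITIONAL; nothing discharged as a node; K0⁷ ∕ K1⁷ NOT closed. [cite: Balaban1989LargeFieldII, Thm 1 p.355, (0.1) pp.355–356, p.391; Balaban1989LargeFieldI, (0.2)–(0.6) p.176, (1.2) p.178, (1.10)–(1.11) p.179, (1.73) p.192, Prop. 1 (1.78) p.194, (1.80) p.195, (1.89) p.198, (1.91)–(1.102) pp.199–201; Balaban1988Convergent, (2.1)–(2.8) pp.254–256, (2.17) p.257, (2.20)–(2.22) p.258, Thm 1 p.262, (3.16)–(3.25) pp.268–270; Balaban1987RG1, (0.20) p.256, (1.12) p.262; Balaban1985RegularSpaces, (1.3)–(1.6) p.77, Thm 8 p.101 (surviving form); Balaban1985Variational, Thm 1 p.279 (witness letters) (bookkeeping)] -/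
theorem nodesAtSomeRecordS₁₃SepCoPH_of_upS_fourPinW₀_pinnedΛΩχZ_ofHistoryBlind_ofCured_theta13OfThm1CCM_of_massLive_of_gauge9TopStepR_of_betaBox
    (hε : 0 < ε₀) (hε' : 0 < ε₂₉) (hB : 0 ≤ B₃) (hB' : 0 ≤ B₃') (ha₀ : 0 < a₀) (ha₁ : 0 < a₁)
    -- K0⁷'s R-ROAD LETTERS (plan V14 stub 3's hypotheses at `M := F.L ^ jM`, floor `c`) + the β-box leaf at the witness (§0)
    (hjm : jM + 1 ≤ F.m) (h15 : VariationalThm1RegSepCoP7M F N B₃ a₀ a₁) {c : ℕ} (hc : c ≤ F.L ^ jM)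
    (h9 : Gauge9RegSepTopStepR F N (fun ν K Ω => suppDomOfRecord F ν K Ω) (F.L ^ jM) c B₃ B₃' a₀ a₁)
    {bK β' : ℝ} (hbK : 0 ≤ bK) (hβlo : BetaLowerH bK (1 / 2) (betaOfRecord₁₃ F N (theta13OfThm1CCM F N jM ε₀ ε₂₉ B₃ B₃' a₀ a₁))) (hβhi : BetaUpperH β' (1 / 2) (betaOfRecord₁₃ F N (theta13OfThm1CCM F N jM ε₀ ε₂₉ B₃ B₃' a₀ a₁))) (hβ' : β' ≤ 3)
    -- the mixed W-pin AT THE LAYER OF RECORD λᴾ: below the torus `W₀ P` IS the bundle of record at λᴾ; elsewhere the closer's leaf-carrying `W₀ P`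
    (hW : ∀ P : B12.RunParams, lam.kSel P < P.K → W₀ P = WOfRecord₁₃ F N (theta13OfThm1CCM F N jM ε₀ ε₂₉ B₃ B₃' a₀ a₁)
      ((lam.pinRPrime₁₃ (theta13OfThm1CCM F N jM ε₀ ε₂₉ B₃ B₃' a₀ a₁)).pinD189ΛH (theta13OfThm1CCM F N jM ε₀ ε₂₉ B₃ B₃' a₀ a₁).ν (theta13OfThm1CCM F N jM ε₀ ε₂₉ B₃ B₃' a₀ a₁).A₁ (theta13OfThm1CCM F N jM ε₀ ε₂₉ B₃ B₃' a₀ a₁).τ9.M (gOfRecord₁₃ F N (theta13OfThm1CCM F N jM ε₀ ε₂₉ B₃ B₃' a₀ a₁))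
        (fun P => (((((σ P).pinZres (theta13OfThm1CCM F N jM ε₀ ε₂₉ B₃ B₃' a₀ a₁).ν (theta13OfThm1CCM F N jM ε₀ ε₂₉ B₃ B₃' a₀ a₁).τ9.M (gOfRecord₁₃ F N (theta13OfThm1CCM F N jM ε₀ ε₂₉ B₃ B₃' a₀ a₁) P) (s P) (N0OfRecord₁₃ (theta13OfThm1CCM F N jM ε₀ ε₂₉ B₃ B₃' a₀ a₁) P (lam.kSel P + 1))).pinSides (theta13OfThm1CCM F N jM ε₀ ε₂₉ B₃ B₃' a₀ a₁).ν (gOfRecord₁₃ F N (theta13OfThm1CCM F N jM ε₀ ε₂₉ B₃ B₃' a₀ a₁) P) (lam.kSel P + 1 - Nm P) (lam.kSel P + 1)).pinXΩ4 (s P) (enlD F (theta13OfThm1CCM F N jM ε₀ ε₂₉ B₃ B₃' a₀ a₁).ν (theta13OfThm1CCM F N jM ε₀ ε₂₉ B₃ B₃' a₀ a₁).τ9.M P (gOfRecord₁₃ F N (theta13OfThm1CCM F N jM ε₀ ε₂₉ B₃ B₃' a₀ a₁) P))).pinOmegaPP (s P) (Nm P) (enlD F (theta13OfThm1CCM F N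 jM ε₀ ε₂₉ B₃ B₃' a₀ a₁).ν (theta13OfThm1CCM F N jM ε₀ ε₂₉ B₃ B₃' a₀ a₁).τ9.M P (gOfRecord₁₃ F N (theta13OfThm1CCM F N jM ε₀ ε₂₉ B₃ B₃' a₀ a₁) P)))) s Nm p₁) P)
    (hWdeg : ∀ P : B12.RunParams, P.K ≤ lam.kSel P → B15Leaf (W₀ P))
    (hC : w.C = (datumOfRecord₁₃SepCoPH F N (Stage13HParams.ofHistoryBlind F N (Stage13RParams.ofCured F N (theta13OfThm1CCM F N jM ε₀ ε₂₉ B₃ B₃' a₀ a₁))) (provisos₁₃SepCoP_theta13OfThm1CCM_of_gauge9TopStepR_of_betaBox hjm hε hε' hB hB' ha₀ ha₁ h15 hc h9 hbK hβlo hβhi hβ').ofCured.ofHistoryBlind).C) (hγ : 0 < w.γ ∧ w.γ ≤ (theta13OfThm1CCM F N jM ε₀ ε₂₉ B₃ B₃' a₀ a₁).γ) (hL : w.L = ((theta13OfThm1CCM F N jM ε₀ ε₂₉ B₃ B₃' a₀ a₁).L : ℝ))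
    (hup : ∀ P, w.up P = upOfRecord₅CS F N ((((((Stage13HParams.ofHistoryBlind F N (Stage13RParams.ofCured F N (theta13OfThm1CCM F N jM ε₀ ε₂₉ B₃ B₃' a₀ a₁))).toStage5₁₃CoPH F N).pinB10 F N).pinY F N (Y9OfRecord N (theta13OfThm1CCM F N jM ε₀ ε₂₉ B₃ B₃' a₀ a₁).toStage3Params Mstar ops)).pinZ F N (Z11OfRecord F N ζ)).pinW F N W₀) P)
    (h05S : ∀ P : B12.RunParams, (upOfRecord₅CS F N ((((((Stage13HParams.ofHistoryBlind F N (Stage13RParams.ofCured F N (theta13OfThm1CCM F N jM ε₀ ε₂₉ B₃ B₃' a₀ a₁))).toStage5₁₃CoPH F N).pinB10 F N).pinY F N (Y9OfRecord N (theta13OfThm1CCM F N jM ε₀ ε₂₉ B₃ B₃' a₀ a₁).toStage3Params Mstar ops)).pinZ F N (Z11OfRecord F N ζ)).pinW F N W₀) P).b8)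
    (h06 : B9LeafX (Y9OfRecord N (theta13OfThm1CCM F N jM ε₀ ε₂₉ B₃ B₃' a₀ a₁).toStage3Params Mstar ops))
    (h07 : B11Leaf (Z11OfRecord F N ζ))
    (h08 : PrintedUV3V N (theta13OfThm1CCM F N jM ε₀ ε₂₉ B₃ B₃' a₀ a₁).L)
    (h09 : ∀ P : B12.RunParams, B12Sec2to5.Lemma4Printed ((theta13OfThm1CCM F N jM ε₀ ε₂₉ B₃ B₃' a₀ a₁).res.X P).F12 ((theta13OfThm1CCM F N jM ε₀ ε₂₉ B₃ B₃' a₀ a₁).res.X P).c12)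
    (h09T : ∀ P : B12.RunParams, (leavesP w P).smallCouplings → (leavesP w P).smallFieldInductive)
    (h10 : ∀ P : B12.RunParams, B9LeafX (Y9OfRecord N (theta13OfThm1CCM F N jM ε₀ ε₂₉ B₃ B₃' a₀ a₁).toStage3Params Mstar ops) →
      (B10.Thm1PrintedCompact (((((((Stage13HParams.ofHistoryBlind F N (Stage13RParams.ofCured F N (theta13OfThm1CCM F N jM ε₀ ε₂₉ B₃ B₃' a₀ a₁))).toStage5₁₃CoPH F N).pinB10 F N).pinY F N (Y9OfRecord N (theta13OfThm1CCM F N jM ε₀ ε₂₉ B₃ B₃' a₀ a₁).toStage3Params Mstar ops)).pinZ F N (Z11OfRecord F N ζ)).pinW F N W₀).res.X P).runs10 ∧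
          B10.Thm2Printed (((((((Stage13HParams.ofHistoryBlind F N (Stage13RParams.ofCured F N (theta13OfThm1CCM F N jM ε₀ ε₂₉ B₃ B₃' a₀ a₁))).toStage5₁₃CoPH F N).pinB10 F N).pinY F N (Y9OfRecord N (theta13OfThm1CCM F N jM ε₀ ε₂₉ B₃ B₃' a₀ a₁).toStage3Params Mstar ops)).pinZ F N (Z11OfRecord F N ζ)).pinW F N W₀).res.X P).runs10) →
        B11Leaf (Z11OfRecord F N ζ) → B12Sec2to5.Lemma4Printed ((theta13OfThm1CCM F N jM ε₀ ε₂₉ B₃ B₃' a₀ a₁).res.X P).F12 ((theta13OfThm1CCM F N jM ε₀ ε₂₉ B₃ B₃' a₀ a₁).res.X P).c12 →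
          B13.Lemma1Printed ((theta13OfThm1CCM F N jM ε₀ ε₂₉ B₃ B₃' a₀ a₁).res.X P).S13 ((theta13OfThm1CCM F N jM ε₀ ε₂₉ B₃ B₃' a₀ a₁).res.X P).c13 ∧ B13.Lemma2Printed ((theta13OfThm1CCM F N jM ε₀ ε₂₉ B₃ B₃' a₀ a₁).res.X P).S13 ((theta13OfThm1CCM F N jM ε₀ ε₂₉ B₃ B₃' a₀ a₁).res.X P).c13 ∧
            B13.Lemma3Printed ((theta13OfThm1CCM F N jM ε₀ ε₂₉ B₃ B₃' a₀ a₁).res.X P).S13 ((theta13OfThm1CCM F N jM ε₀ ε₂₉ B₃ B₃' a₀ a₁).res.X P).c13)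
    (h11 : ∀ P : B12.RunParams, (leavesP w P).b7 → (leavesP w P).b8 → (leavesP w P).b9 → (leavesP w P).b10 → (leavesP w P).b11 →
      (leavesP w P).smallCouplings → (leavesP w P).smallFieldInductive → (leavesP w P).flowControl →
        ∀ k, k < P.K → SLaw₁₃CoPH F N (Stage13HParams.ofHistoryBlind F N (Stage13RParams.ofCured F N (theta13OfThm1CCM F N jM ε₀ ε₂₉ B₃ B₃' a₀ a₁))) P k → TLaw₁₃CoPH F N (Stage13HParams.ofHistoryBlind F N (Stage13RParams.ofCured F N (theta13OfThm1CCM F N jM ε₀ ε₂₉ B₃ B₃' a₀ a₁))) P k)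
    (hUV : ∀ P : B12.RunParams, (genFlow (betaOfRecord₁₃ F N (theta13OfThm1CCM F N jM ε₀ ε₂₉ B₃ B₃' a₀ a₁)) P.g0).InInterval w.γ P.K → ∀ k, k ≤ P.K → SLaw₁₃CoPH F N (Stage13HParams.ofHistoryBlind F N (Stage13RParams.ofCured F N (theta13OfThm1CCM F N jM ε₀ ε₂₉ B₃ B₃' a₀ a₁))) P k →
      ∀ U : GaugeField (F.P P.K) k (SU N),
        chiβOfRecord₁₃ F N (theta13OfThm1CCM F N jM ε₀ ε₂₉ B₃ B₃' a₀ a₁) P.K (gOfRecord₁₃ F N (theta13OfThm1CCM F N jM ε₀ ε₂₉ B₃ B₃' a₀ a₁) P) k U *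
              Real.exp (-(1 / (gOfRecord₁₃ F N (theta13OfThm1CCM F N jM ε₀ ε₂₉ B₃ B₃' a₀ a₁) P k) ^ 2 * wilsonBGOfRecord F N (theta13OfThm1CCM F N jM ε₀ ε₂₉ B₃ B₃' a₀ a₁).εbg P k U)
                - w.em (gOfRecord₁₃ F N (theta13OfThm1CCM F N jM ε₀ ε₂₉ B₃ B₃' a₀ a₁) P k) * (Fintype.card (Site (F.P P.K) k) : ℝ)) ≤ densOfRecord₁₃ F N (theta13OfThm1CCM F N jM ε₀ ε₂₉ B₃ B₃' a₀ a₁) P k U ∧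
        densOfRecord₁₃ F N (theta13OfThm1CCM F N jM ε₀ ε₂₉ B₃ B₃' a₀ a₁) P k U ≤ Real.exp (w.ep (gOfRecord₁₃ F N (theta13OfThm1CCM F N jM ε₀ ε₂₉ B₃ B₃' a₀ a₁) P k) * (Fintype.card (Site (F.P P.K) k) : ℝ)))
    -- N12 AT THE LAYER OF RECORD: 12P's located per-run inputs, run by run, BELOW THE TORUS ONLY (`D P` abbreviates the pinned (1.89) setting `λᴾ.D189 P`)
    (D : ∀ P : B12.RunParams, Setting189 (F.P P.K) (SU N) (MSField (F.P P.K) (SU N) × ((j : ℕ) → VecField (F.P P.K) j (EuclideanSpace ℝ (Fin (N ^ 2 - 1))))) (Pt (F.P P.K).d))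
    (hD : ∀ P : B12.RunParams, D P = ((lam.pinRPrime₁₃ (theta13OfThm1CCM F N jM ε₀ ε₂₉ B₃ B₃' a₀ a₁)).pinD189ΛH (theta13OfThm1CCM F N jM ε₀ ε₂₉ B₃ B₃' a₀ a₁).ν (theta13OfThm1CCM F N jM ε₀ ε₂₉ B₃ B₃' a₀ a₁).A₁ (theta13OfThm1CCM F N jM ε₀ ε₂₉ B₃ B₃' a₀ a₁).τ9.M (gOfRecord₁₃ F N (theta13OfThm1CCM F N jM ε₀ ε₂₉ B₃ B₃' a₀ a₁)) (fun P => (((((σ P).pinZres (theta13OfThm1CCM F N jM ε₀ ε₂₉ B₃ B₃' a₀ a₁).ν (theta13OfThm1CCM F N jM ε₀ ε₂₉ B₃ B₃' a₀ a₁).τ9.M (gOfRecord₁₃ F N (theta13OfThm1CCM F N jM ε₀ ε₂₉ B₃ B₃' a₀ a₁) P) (s P) (N0OfRecord₁₃ (theta13OfThm1CCM F N jM ε₀ ε₂₉ B₃ B₃' a₀ a₁) P (lam.kSel P + 1))).pinSides (theta13OfThm1CCM F N jM ε₀ ε₂₉ B₃ B₃' a₀ a₁).ν (gOfRecord₁₃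 F N (theta13OfThm1CCM F N jM ε₀ ε₂₉ B₃ B₃' a₀ a₁) P) (lam.kSel P + 1 - Nm P) (lam.kSel P + 1)).pinXΩ4 (s P) (enlD F (theta13OfThm1CCM F N jM ε₀ ε₂₉ B₃ B₃' a₀ a₁).ν (theta13OfThm1CCM F N jM ε₀ ε₂₉ B₃ B₃' a₀ a₁).τ9.M P (gOfRecord₁₃ F N (theta13OfThm1CCM F N jM ε₀ ε₂₉ B₃ B₃' a₀ a₁) P))).pinOmegaPP (s P) (Nm P) (enlD F (theta13OfThm1CCM F N jM ε₀ ε₂₉ B₃ B₃' a₀ a₁).ν (theta13OfThm1CCM F N jM ε₀ ε₂₉ B₃ B₃' a₀ a₁).τ9.M P (gOfRecord₁₃ F N (theta13OfThm1CCM F N jM ε₀ ε₂₉ B₃ B₃' a₀ a₁) P)))) s Nm p₁).D189 P)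
    (hmassLive : ∀ P : B12.RunParams, lam.kSel P < P.K → ∀ a, LiveSeq F N (theta13OfThm1CCM F N jM ε₀ ε₂₉ B₃ B₃' a₀ a₁).ν (theta13OfThm1CCM F N jM ε₀ ε₂₉ B₃ B₃' a₀ a₁).τ9 P (gOfRecord₁₃ F N (theta13OfThm1CCM F N jM ε₀ ε₂₉ B₃ B₃' a₀ a₁) P) (lam.kSel P + 1)
        (slotsTOfRecord F N (theta13OfThm1CCM F N jM ε₀ ε₂₉ B₃ B₃' a₀ a₁).ν (theta13OfThm1CCM F N jM ε₀ ε₂₉ B₃ B₃' a₀ a₁).τ9 (EOfRecord₁₃ F N (theta13OfThm1CCM F N jM ε₀ ε₂₉ B₃ B₃' a₀ a₁)) (wOfRecord₉ F N (theta13OfThm1CCM F N jM ε₀ ε₂₉ B₃ B₃' a₀ a₁).toStage9Params)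
          (theta13OfThm1CCM F N jM ε₀ ε₂₉ B₃ B₃' a₀ a₁).ppSel P (gOfRecord₁₃ F N (theta13OfThm1CCM F N jM ε₀ ε₂₉ B₃ B₃' a₀ a₁) P) (lam.kSel P + 1)) a →
      0 < ∫ V, rterm (reprTOfRecord₁₃ F N (theta13OfThm1CCM F N jM ε₀ ε₂₉ B₃ B₃' a₀ a₁) P (lam.kSel P)) a V ∂(fieldMeasure (F.P P.K) (lam.kSel P + 1) (SU N)))
    (hP1 : ∀ P : B12.RunParams, lam.kSel P < P.K → Prop1Printed (lam.LF P))
    (hlog : ∀ P : B12.RunParams, lam.kSel P < P.K → 1 < (Real.log (gOfRecord₁₃ F N (theta13OfThm1CCM F N jM ε₀ ε₂₉ B₃ B₃' a₀ a₁) P (lam.kSel P + 1) ^ 2)⁻¹) ^ (theta13OfThm1CCM F N jM ε₀ ε₂₉ B₃ B₃' a₀ a₁).ν.r)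
    (hNN : ∀ P : B12.RunParams, lam.kSel P < P.K → N0OfRecord₁₃ (theta13OfThm1CCM F N jM ε₀ ε₂₉ B₃ B₃' a₀ a₁) P (lam.kSel P + 1) ≤ Nm P)
    (hNk : ∀ P : B12.RunParams, lam.kSel P < P.K → N0OfRecord₁₃ (theta13OfThm1CCM F N jM ε₀ ε₂₉ B₃ B₃' a₀ a₁) P (lam.kSel P + 1) ≤ lam.kSel P + 1)
    (hβ0 : ∀ P : B12.RunParams, lam.kSel P < P.K → 0 ≤ (σ P).β)
    (hβ : ∀ P : B12.RunParams, lam.kSel P < P.K → (σ P).β ≤ 1 / 4)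
    (hL₀ : ∀ P : B12.RunParams, lam.kSel P < P.K → 2 ≤ (σ P).L₀)
    (hL₀L : ∀ P : B12.RunParams, lam.kSel P < P.K → (σ P).L₀ ^ 2 ≤ ((F.P P.K).L : ℝ))
    (hBB : ∀ P : B12.RunParams, lam.kSel P < P.K → 0 ≤ (σ P).O1 * (σ P).B₃ * (σ P).B₅)
    (hδ : ∀ P : B12.RunParams, lam.kSel P < P.K → 0 ≤ (σ P).δ)
    (hN₀ : ∀ P : B12.RunParams, lam.kSel P < P.K → (2 + (121 / 120) ^ 2 * ((σ P).O1 * (σ P).B₃ * (σ P).B₅ * ((theta13OfThm1CCM F N jM ε₀ ε₂₉ B₃ B₃' a₀ a₁).τ9.M : ℝ) ^ 5)) *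
      ((((σ P).L₀ ^ 2) ^ (N0OfRecord₁₃ (theta13OfThm1CCM F N jM ε₀ ε₂₉ B₃ B₃' a₀ a₁) P (lam.kSel P + 1) - 1))⁻¹) ≤ 1 / 4)
    (hMl : ∀ P : B12.RunParams, lam.kSel P < P.K → (121 / 120) ^ 2 * ((σ P).O1 * (σ P).B₃ * (σ P).B₅ * ((theta13OfThm1CCM F N jM ε₀ ε₂₉ B₃ B₃' a₀ a₁).τ9.M : ℝ) ^ 5) * Real.exp (-(4 * (σ P).δ * ((theta13OfThm1CCM F N jM ε₀ ε₂₉ B₃ B₃' a₀ a₁).τ9.M : ℝ))) ≤ 1 / 12)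
    (hε0 : ∀ P : B12.RunParams, lam.kSel P < P.K → ∀ i, lam.kSel P + 1 - Nm P ≤ i → i ≤ lam.kSel P + 1 → 0 ≤ epsOfRecord (theta13OfThm1CCM F N jM ε₀ ε₂₉ B₃ B₃' a₀ a₁).ν (gOfRecord₁₃ F N (theta13OfThm1CCM F N jM ε₀ ε₂₉ B₃ B₃' a₀ a₁) P) i)
    (hε1 : ∀ P : B12.RunParams, lam.kSel P < P.K → ∀ i, lam.kSel P + 1 - Nm P ≤ i → i ≤ lam.kSel P + 1 → epsOfRecord (theta13OfThm1CCM F N jM ε₀ ε₂₉ B₃ B₃' a₀ a₁).ν (gOfRecord₁₃ F N (theta13OfThm1CCM F N jM ε₀ ε₂₉ B₃ B₃' a₀ a₁) P) i ≤ 1 / 10)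
    {β₀ : ℝ}
    (hβ₀0 : 0 ≤ β₀)
    (hβ₀ : β₀ ≤ 1 / 2)
    (hflow : ∀ P : B12.RunParams, lam.kSel P < P.K → ∀ j, lam.kSel P + 1 - Nm P ≤ j → j < lam.kSel P + 1 → epsOfRecord (theta13OfThm1CCM F N jM ε₀ ε₂₉ B₃ B₃' a₀ a₁).ν (gOfRecord₁₃ F N (theta13OfThm1CCM F N jM ε₀ ε₂₉ B₃ B₃' a₀ a₁) P) (lam.kSel P + 1)
      ≤ (1 + β₀) * Real.sqrt ((lam.kSel P + 1 - j : ℕ) : ℝ) * epsOfRecord (theta13OfThm1CCM F N jM ε₀ ε₂₉ B₃ B₃' a₀ a₁).ν (gOfRecord₁₃ F N (theta13OfThm1CCM F N jM ε₀ ε₂₉ B₃ B₃' a₀ a₁) P) j)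
    {b γ : ℝ}
    (hb : 0 ≤ b)
    (hlow : BetaLowerH b γ (betaOfRecord₁₃ F N (theta13OfThm1CCM F N jM ε₀ ε₂₉ B₃ B₃' a₀ a₁)))
    (hγ1 : γ ≤ 1)
    (hI : ∀ P : B12.RunParams, lam.kSel P < P.K → Step.InInterval γ P.K (gOfRecord₁₃ F N (theta13OfThm1CCM F N jM ε₀ ε₂₉ B₃ B₃' a₀ a₁) P))
    (hΛ : ∀ P : B12.RunParams, lam.kSel P < P.K → (((enlD F (theta13OfThm1CCM F N jM ε₀ ε₂₉ B₃ B₃' a₀ a₁).ν (theta13OfThm1CCM F N jM ε₀ ε₂₉ B₃ B₃' a₀ a₁).τ9.M P (gOfRecord₁₃ F N (theta13OfThm1CCM F N jM ε₀ ε₂₉ B₃ B₃' a₀ a₁) P)) 4 (lam.kSel P + 1 + 1 - (N0OfRecord₁₃ (theta13OfThm1CCM F N jM ε₀ ε₂₉ B₃ B₃' a₀ a₁) P (lam.kSel P + 1)))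
        (omegaOfChain (s P) (lam.kSel P + 1 + 1 - (N0OfRecord₁₃ (theta13OfThm1CCM F N jM ε₀ ε₂₉ B₃ B₃' a₀ a₁) P (lam.kSel P + 1)))))ᶜ ∩ (σ P).Z).Nonempty)
    (L91h : ∀ P : B12.RunParams, lam.kSel P < P.K → ∀ U, new189 (D P) U → ∀ p ∈ plaqsOf (half (D P)),
      Ineq191 (dist1 (plaqHol ((D P).Upp U) p)) ((D P).devV'' U p) (D P).α (((D P).L ^ (D P).h)⁻¹) ((D P).ε (D P).h) (E124 (D P).ε (D P).L (D P).η (D P).k (D P).h))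
    (L95 : ∀ P : B12.RunParams, lam.kSel P < P.K → ∀ U, new189 (D P) U → ∀ p ∈ plaqsOf (half (D P)),
      Ineq195 ((D P).devV'' U p) (dist1 (plaqHol ((D P).Uhalf U ((D P).boxOf p)) p)) (D P).α (((D P).L ^ (D P).h)⁻¹) ((D P).ε (D P).h) (E124 (D P).ε (D P).L (D P).η (D P).k (D P).h))
    (L91 : ∀ P : B12.RunParams, lam.kSel P < P.K → ∀ U, new189 (D P) U → ∀ j, (D P).h ≤ j → j ≤ (D P).k → ∀ p ∈ plaqsOf (dom (D P) j),
      Ineq191 (dist1 (plaqHol ((D P).Upp U) p)) ((D P).dev97 U p) (D P).α (((D P).L ^ j)⁻¹) ((D P).ε j) (E124 (D P).ε (D P).L (D P).η (D P).k j))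
    (L97 : ∀ P : B12.RunParams, lam.kSel P < P.K → ∀ U, new189 (D P) U → ∀ j, (D P).h ≤ j → j ≤ (D P).k → ∀ p ∈ plaqsOf (dom (D P) j),
      Ineq191 ((D P).dev97 U p) ((D P).dev0 U p) (D P).α (((D P).L ^ j)⁻¹) ((D P).ε j) (E124 (D P).ε (D P).L (D P).η (D P).k j))
    (L80 : ∀ P : B12.RunParams, lam.kSel P < P.K → ∀ U, new189 (D P) U → ∀ j, (D P).h ≤ j → j ≤ (D P).k → ∀ p ∈ plaqsOf (dom (D P) j),
      Ineq180 ((D P).dev0 U p) ((D P).ε (D P).k) (D P).η (D P).B₃ (D P).B₅ (D P).M (D P).δ ((D P).dist p) (D P).O1)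
    (hsel : ∀ P : B12.RunParams, 1 ≤ P.K → lam.kSel P < P.K) :
    ∃ (θ' : Stage13HParams F N) (h' : θ'.Provisos₁₃SepCoPH F N) (w : WorldP), (θ'.ZhUnity F N ∧ θ'.SlotsNondegenerate₁₃ F N) ∧ θ'.Admissible F N ∧
      (∃ (θ'' : Stage13HParams F N) (h'' : θ''.Provisos₁₃SepCoPH F N), θ''.Admissible F N ∧
        datumOfRecord₁₃SepCoPH F N θ' h' = datumOfRecord₁₃SepCoPH F N θ'' h'' ∧ w.C = (datumOfRecord₁₃SepCoPH F N θ' h').C ∧ (0 < w.γ ∧ w.γ ≤ θ''.γ) ∧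
        w.L = (θ''.L : ℝ) ∧ ∀ P : B12.RunParams, w.up P = upOfRecord₅CS F N (θ''.toStage5₁₃CoPH F N) P) ∧
      (∀ P : B12.RunParams, Nodes (leavesP w P)) ∧ PrintedUV3V N θ'.L ∧
      ∃ lam : ResidW F N, (∀ P : B12.RunParams, 1 ≤ P.K → lam.kSel P < P.K) ∧
        ∀ P : B12.RunParams, lam.kSel P < P.K → ((leavesP w P).rBasicStep ↔ B15Leaf (WOfRecord₁₃ F N θ'.toStage13Params lam P)) :=
  nodesAtSomeRecordS₁₃SepCoPH_of_upS_fourPinW₀_pinnedΛΩχZ_ofHistoryBlind_ofCured_liveRepin₁₃_of_massLive_of_hasResiduals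
    (theta13OfNumerics F N (stage12NumericsOfThm1CCM F.L jM ε₀ B₃ B₃' a₀ a₁) ε₂₉ (zeta316OfRecord F N (stage12NumericsOfThm1CCM F.L jM ε₀ B₃ B₃' a₀ a₁).ν (stage12NumericsOfThm1CCM F.L jM ε₀ B₃ B₃' a₀ a₁).τ9.M (stage12NumericsOfThm1CCM F.L jM ε₀ B₃ B₃' a₀ a₁).A₁) (RzOfRecord F N) (ZtOfRecord F N)) lam σ s Nm p₁ Mstar ops ζ W₀ w
    (hasResidualsOfRecord_theta13OfNumerics F N (stage12NumericsOfThm1CCM F.L jM ε₀ B₃ B₃' a₀ a₁) ε₂₉) (provisos₁₃SepCoP_theta13OfThm1CCM_of_gauge9TopStepR_of_betaBox hjm hε hε' hB hB' ha₀ ha₁ h15 hc h9 hbK hβlo hβhi hβ')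
    (admissible_theta13OfNumerics F N (zeta316OfRecord F N (stage12NumericsOfThm1CCM F.L jM ε₀ B₃ B₃' a₀ a₁).ν (stage12NumericsOfThm1CCM F.L jM ε₀ B₃ B₃' a₀ a₁).τ9.M (stage12NumericsOfThm1CCM F.L jM ε₀ B₃ B₃' a₀ a₁).A₁) (RzOfRecord F N) (ZtOfRecord F N) (stage12NumericsOfThm1CCM_pos F.hL.2.le hε hB hB' ha₀ ha₁) hε')
    (kappa_nonneg_theta13OfThm1CCM F N jM ε₀ ε₂₉ B₃ B₃' a₀ a₁) (E0_nonneg_theta13OfThm1CCM F N jM ε₀ ε₂₉ B₃ B₃' a₀ a₁) (B0_nonneg_theta13OfThm1CCM F N jM ε₀ ε₂₉ B₃ B₃' a₀ a₁)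
    hW hWdeg hC hγ hL hup h05S h06 h07 h08 h09 h09T h10 h11 hUV
    Nat.one_pos -- `M₂ = 1` at the collared member (`theta13OfThm1CCM_M₂`, `rfl`)
    (pow_pos (Nat.zero_lt_of_lt F.hL.2) jM) -- `M = L^{jM} > 0`
    D hD hmassLive hP1 hlog hNN hNk hβ0 hβ hL₀ hL₀L hBB hδ hN₀ hMl hε0 hε1 hβ₀0 hβ₀ hflow hb hlow hγ1 hI hΛ L91h L95 L91 L97 L80 hsel

end PinnedOfStepR

end Summit.QuantumFields.YangMills.BalabanUVNodes.N12AtTheta13OfThm1CCMOfStepR
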